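import Mathlib
import HarnessLib
import Summits.ValiantsHypothesis.ValiantsHypothesis.Theses.MonotoneRestoration
import Literature.Computability.AlgebraicComplexity.PatternExpressions
import Literature.Computability.AlgebraicComplexity.DawarWilsenach2025
import Literature.Combinatorics.SimpleGraph.TreeDecomposition

/-!
# Skeleton — crux `OrbitRestorationQP`, line `narrow-expansion` (crux-strategist, gen 1)

Crux item `stmt-ValiantsHypothesis-18293`
(`Summit.ValiantsHypothesis.ValiantsHypothesis.Theses.MonotoneRestoration.OrbitRestorationQP`, the SOLE
binder of the route's `closes`): every matrix-symmetric `VP` family over `ℂ` has square-symmetric circuits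
of quasi-polynomial ORBIT size (number of gates unbounded).

THE CUT.  Because the crux bounds ORBITS and not SIZE, its converse-direction engine needs no complexity
measure at all, and the crux factors through a statement of pure linear algebra:

* `stub_narrowExpansionVP` (K1, NARROW HOM-EXPANSION, conjecture-grade — the load-bearing stub): for every
  matrix-symmetric `VP` family `f` there is `c` with, for every `n`,
  `f n ∈ span_ℂ { hom_{F,n} : F a bipartite multigraph pattern of treewidth ≤ (log₂ n + c)^c }`
  (tree `homPoly`, `Literature.Combinatorics.SimpleGraph.treewidth` of the pattern graph on `Fin a ⊕ Fin b`).
  No circuit, no orbit, no bound on the number of patterns or on the coefficients: the hom expansion of a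
  matrix-symmetric polynomial in patterns with `≤ n` vertices a side and no isolated vertices is UNIQUE
  (orbit sums of monomials ↔ injective hom polynomials ↔ hom polynomials, Möbius inversion over vertex
  partitions; DwivediPagoSeppelt2026 p.12), so K1 says: the coefficient functional `c_F(f_n)` vanishes on
  every pattern `F` of treewidth `> (log₂ n + c)^c`.  Refutation instrument: ONE matrix-symmetric `VP` family
  and ONE wide pattern with a nonzero coefficient, infinitely often beyond every polylog — computable exactly
  for small `n`.  By Dvořák / Dell–Grohe–Rattan (tree `Dvorak2010_ckEquiv_iff_homCount_holds`) this is the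
  algebraic dual of "counting width polylog"; unlike the counting-width form it sees all of `f n`, not only
  its values on 0/1 matrices.
* `stub_homPoly_close` (K2, FOLKLORE BRIDGE, provable now, size M/L): a pattern of treewidth `≤ w` is, for
  `n ≥ 1`, the closed polynomial of a labelled pattern expression (tree `PatternExpr`, the bipartite graph
  algebra) with any numbers `k, l ≥ w + 1` of row and column labels (Lovász's labelled quantum graphs; the
  `1/n` constants of `ℂ` absorb unused labels — hence `1 ≤ n`).  This is exactly the bridge the docstring of
  `Literature/…/PatternExpressions.lean` records as "folklore and not formalised here".
* `stub_close_orbit` (K3, LENGTH-FREE ORBIT BOUND, provable now, size L): the closed polynomial of ANY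
  expression with `k` row and `l` column labels has a square-symmetric circuit whose every gate orbit has
  size `≤ (n+1)^(k+l+2)` — independent of the length of the expression (gates = one variable gate per
  `x_ij` (orbit ≤ n²) ⊕ one constant gate per value (fixed by every automorphism,
  `IsAutomorphismExtending.apply_eq_self_of_label_const`) ⊕ (sub-expression OCCURRENCE `o`) × (label
  assignments `(ρ, γ)`), each occurrence family made automorphism-invariant by a pair of fresh constant
  children `t_o`, `t_o⁻¹`, so an orbit never leaves its family of `n^{k+l}` gates; `n = 0` is a constant).
  The orbit analogue of THEOREM ζ-P (`zeta_symmetric_patternExpr_close`, which bounds SIZE by the length).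
* `OrbitRestorationQP_of : K1 → K2 → K3 → OrbitRestorationQP` — kernel-checked below: `Submodule.span_induction`
  turns a span certificate into ONE expression (`add`, `mul (const a)`), K3 turns it into a circuit, and
  `(n+1)^(2W+2) ≤ 2^((log₂ n + c + 3)^(c+3))` for `W = (log₂ n + c)^c + 1`.

Honours `Theorems/MonotoneRestorationQP/Negative/OrbitRestorationFalseWithoutVP.lean` (the `VP` hypothesis
is kept in K1: `per_n`'s unique expansion contains every `n`-edge bipartite multigraph, in particular
expanders of linear treewidth — and K2 ∧ K3 ∧ Dawar–Wilsenach Thm 7.1 PROVE that `per_n` is not in the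
narrow span, an unconditional corollary recorded on the line card).  No `Disproof.lean` exists yet for this
crux.
-/

set_option linter.dupNamespace false

namespace Summit.ValiantsHypothesis.ValiantsHypothesis.Cruxes.OrbitRestorationQP.NarrowExpansion

open Summit.ValiantsHypothesis.ValiantsHypothesis.Theses.MonotoneRestoration
open Literature.Computability.AlgebraicComplexity

/-! ### The three stubs -/

/-- **K1 — NARROW HOM-EXPANSION OF MATRIX-SYMMETRIC `VP` FAMILIES** (load-bearing, conjecture-grade).
Every family `f_n ∈ ℂ[x_ij : i, j < n]` invariant under independent row and column permutations that is a
`VP` family lies, for every `n`, in the `ℂ`-span of the homomorphism polynomials `hom_{F,n}` (tree `homPoly`)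
of bipartite multigraph patterns `F = (Fin a ⊔ Fin b, E)` whose pattern graph has treewidth
`≤ (log₂ n + c)^c`, for one constant `c`.  Why it might fail: an "arithmetic CFI family in characteristic 0"
— a matrix-symmetric `VP` family whose unique hom expansion charges patterns of treewidth `ω(polylog n)`
(DawarWilsenach2025 §8 expect this for `VP` at large; DwivediPagoSeppelt2026 Outlook Q3).
[conjecture-grade; cite: DawarPagoSeppelt2025 Thm 1.1 and §5; DwivediPagoSeppelt2026 eq. (1), Cor 3.3,
Outlook Q3; DawarWilsenach2025 Thm 6.4] -/
theorem stub_narrowExpansionVP :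
    ∀ f : (n : ℕ) → MvPolynomial (Fin n × Fin n) ℂ,
      (∀ (n : ℕ) (σ τ : Equiv.Perm (Fin n)),
        MvPolynomial.rename (fun p : Fin n × Fin n => (σ p.1, τ p.2)) (f n) = f n) →
      IsVPFamily f →
      ∃ c : ℕ, ∀ n : ℕ, f n ∈ Submodule.span ℂ
        {p : MvPolynomial (Fin n × Fin n) ℂ | ∃ (a b : ℕ) (E : Multiset (Fin a × Fin b)),
          Literature.Combinatorics.SimpleGraph.treewidth
              (SimpleGraph.fromRel fun u v : Fin a ⊕ Fin b =>
                ∃ e ∈ E, u = Sum.inl e.1 ∧ v = Sum.inr e.2) ≤ (Nat.log 2 n + c) ^ c ∧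
            p = homPoly E n ℂ} := by
  sorry

/-- **K2 — BOUNDED TREEWIDTH ⇒ NARROW LABELLED EXPRESSION** (folklore bridge, provable now).  If the
pattern graph of the bipartite multigraph `(Fin a ⊔ Fin b, E)` has treewidth `≤ w`, then for every `n ≥ 1`
and all label budgets `k, l ≥ w + 1` the homomorphism polynomial `hom_{F,n}` is the closed polynomial of a
labelled pattern expression with `k` row labels and `l` column labels (root a width-`w` tree decomposition;
colour the vertices top-down so that labels are injective on every bag — rows from `Fin k`, columns from
`Fin l`; introduce each edge of `E` once at a bag containing it, `sumRow`/`sumCol` a vertex when its subtree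
is left, and multiply by the constant `n⁻ʳ` for the `r` labels free at the root, which `close` also sums).
Why it might fail: only by mis-typing (the `1 ≤ n` guard and `k, l ≥ w + 1` are exactly what the
normalising constants and the bag colouring need).  [folklore; cite: DawarPagoSeppelt2025 §5 (proof of
Thm 5.3); Lovász, Large networks and graph limits, §6.5; DellGroheRattan2018 Lem. 9] -/
theorem stub_homPoly_close :
    ∀ (a b w : ℕ) (E : Multiset (Fin a × Fin b)),
      Literature.Combinatorics.SimpleGraph.treewidth
          (SimpleGraph.fromRel fun u v : Fin a ⊕ Fin b =>
            ∃ e ∈ E, u = Sum.inl e.1 ∧ v = Sum.inr e.2) ≤ w →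
      ∀ n : ℕ, 1 ≤ n → ∀ k l : ℕ, w + 1 ≤ k → w + 1 ≤ l →
        ∃ e : PatternExpr ℂ k l, e.close n = homPoly E n ℂ := by
  sorry

/-- **K3 — LENGTH-FREE ORBIT BOUND FOR CLOSED EXPRESSIONS** (provable now).  For every `n` and every
labelled pattern expression `e` with `k` row and `l` column labels, the closed polynomial `e.close n` is
computed by a square-symmetric labelled circuit over `ℂ` (diagonal action of `Sym (Fin n)`) all of whose
gate orbits (`LabelledArithCircuit.orbitSize`, Dawar–Wilsenach ORB) have size `≤ (n+1)^(k+l+2)`, whatever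
the length of `e`.  Construction: variable gates (orbit `≤ n²`), one constant gate per value (fixed),
and for every OCCURRENCE `o` of a sub-expression the family of gates indexed by the label assignments
`(ρ, γ)` (`n^{k+l}` of them), each family tagged by two fresh constants `t_o`, `t_o⁻¹` multiplied in
(`t_o · t_o⁻¹ · value`), so that every automorphism — which fixes constant gates — maps a family to itself;
`sumRow a` at `(ρ, γ)` is the `+`-gate over the family members `(ρ[a ↦ v], γ)`; the output is the `+`-gate
over the root family (`n = 0` or no assignments: a constant gate).  Why it might fail: only if orbits under
NON-standard automorphisms could leave a family — excluded by the tags.  [folklore; cite: DawarPagoSeppelt2025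
§5 (proof of Thm 5.3, "for every tuple v ∈ [n]^ℓ a gate which computes F(v)"); DawarWilsenach2025 §3.3] -/
theorem stub_close_orbit :
    ∀ (n k l : ℕ) (e : PatternExpr ℂ k l),
      ∃ (G : Type) (_ : Fintype G) (C : LabelledArithCircuit ℂ (Fin n × Fin n) Unit G),
        C.IsSymmetric (Equiv.Perm (Fin n)) ∧ C.eval (C.output ()) = e.close n ∧
          C.orbitSize (Equiv.Perm (Fin n)) ≤ (n + 1) ^ (k + l + 2) := by
  sorry

/-! ### Proved glue: linearity of `close`, the constant case, the exponent arithmetic -/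

/-- `close` of the zero constant is `0`. [folklore] -/
theorem close_zero (n k l : ℕ) : (PatternExpr.const 0 : PatternExpr ℂ k l).close n = 0 := by
  simp [PatternExpr.close]

/-- `close` is additive. [folklore] -/
theorem close_add (n k l : ℕ) (e₁ e₂ : PatternExpr ℂ k l) :
    (PatternExpr.add e₁ e₂).close n = e₁.close n + e₂.close n := by
  simp only [PatternExpr.close, PatternExpr.value_add, Finset.sum_add_distrib]

/-- `close` of `const a · e` is `a • close e`. [folklore] -/
theorem close_smul (n k l : ℕ) (a : ℂ) (e : PatternExpr ℂ k l) :
    (PatternExpr.mul (PatternExpr.const a) e).close n = a • e.close n := by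
  simp only [PatternExpr.close, PatternExpr.value_mul, PatternExpr.value_const, Finset.smul_sum,
    MvPolynomial.smul_eq_C_mul]

/-- With no labels and `n = 0`, `close` of a constant is that constant. [folklore] -/
theorem close_const_noLabels (r : ℂ) :
    (PatternExpr.const r : PatternExpr ℂ 0 0).close 0 = MvPolynomial.C r := by
  simp [PatternExpr.close]

/-- A span certificate over the narrow patterns is ONE narrow expression (given K2). [folklore] -/
theorem exists_expr_of_mem_span
    (h₂ : ∀ (a b w : ℕ) (E : Multiset (Fin a × Fin b)),
      Literature.Combinatorics.SimpleGraph.treewidth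
          (SimpleGraph.fromRel fun u v : Fin a ⊕ Fin b =>
            ∃ e ∈ E, u = Sum.inl e.1 ∧ v = Sum.inr e.2) ≤ w →
      ∀ n : ℕ, 1 ≤ n → ∀ k l : ℕ, w + 1 ≤ k → w + 1 ≤ l →
        ∃ e : PatternExpr ℂ k l, e.close n = homPoly E n ℂ)
    (n w : ℕ) (hn : 1 ≤ n) (p : MvPolynomial (Fin n × Fin n) ℂ)
    (hp : p ∈ Submodule.span ℂ
        {p : MvPolynomial (Fin n × Fin n) ℂ | ∃ (a b : ℕ) (E : Multiset (Fin a × Fin b)),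
          Literature.Combinatorics.SimpleGraph.treewidth
              (SimpleGraph.fromRel fun u v : Fin a ⊕ Fin b =>
                ∃ e ∈ E, u = Sum.inl e.1 ∧ v = Sum.inr e.2) ≤ w ∧
            p = homPoly E n ℂ}) :
    ∃ e : PatternExpr ℂ (w + 1) (w + 1), e.close n = p := by
  induction hp using Submodule.span_induction with
  | mem p hp =>
    obtain ⟨a, b, E, htw, rfl⟩ := hp
    exact h₂ a b w E htw n hn (w + 1) (w + 1) le_rfl le_rfl
  | zero => exact ⟨PatternExpr.const 0, close_zero n _ _⟩
  | add p q _ _ hp hq =>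
    obtain ⟨e₁, he₁⟩ := hp
    obtain ⟨e₂, he₂⟩ := hq
    exact ⟨PatternExpr.add e₁ e₂, by rw [close_add, he₁, he₂]⟩
  | smul a p _ hp =>
    obtain ⟨e, he⟩ := hp
    exact ⟨PatternExpr.mul (PatternExpr.const a) e, by rw [close_smul, he]⟩

/-- The exponent arithmetic: `(L+1)(2(L+c)^c + 4) ≤ (L+c+3)^(c+3)`. [folklore] -/
theorem width_arith (L c : ℕ) : (L + 1) * (2 * (L + c) ^ c + 4) ≤ (L + (c + 3)) ^ (c + 3) := by
  set m := L + (c + 3) with hm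
  have h1 : (L + c) ^ c ≤ m ^ c := Nat.pow_le_pow_left (by omega) c
  have h2 : 1 ≤ m ^ c := Nat.one_le_pow _ _ (by omega)
  have h3 : 9 ≤ m * m := by nlinarith
  calc (L + 1) * (2 * (L + c) ^ c + 4) ≤ m * (9 * m ^ c) := Nat.mul_le_mul (by omega) (by omega)
    _ ≤ m * (m * m * m ^ c) := Nat.mul_le_mul_left _ (Nat.mul_le_mul_right _ h3)
    _ = m ^ (c + 3) := by ring

/-- The orbit bound of the assembled circuit is quasi-polynomial:
`(n+1)^(W + W + 2) ≤ 2^((log₂ n + c + 3)^(c+3))` for `W = (log₂ n + c)^c + 1`. [folklore] -/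
theorem orbit_bound (n c : ℕ) :
    (n + 1) ^ ((Nat.log 2 n + c) ^ c + 1 + ((Nat.log 2 n + c) ^ c + 1) + 2) ≤
      2 ^ ((Nat.log 2 n + (c + 3)) ^ (c + 3)) := by
  have hL : n < 2 ^ (Nat.log 2 n + 1) := Nat.lt_pow_succ_log_self Nat.one_lt_two n
  generalize Nat.log 2 n = L at hL ⊢
  have hn1 : n + 1 ≤ 2 ^ (L + 1) := hL
  calc (n + 1) ^ ((L + c) ^ c + 1 + ((L + c) ^ c + 1) + 2)
      ≤ (2 ^ (L + 1)) ^ ((L + c) ^ c + 1 + ((L + c) ^ c + 1) + 2) := Nat.pow_le_pow_left hn1 _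
    _ = 2 ^ ((L + 1) * (2 * (L + c) ^ c + 4)) := by rw [← pow_mul]; congr 1; ring
    _ ≤ 2 ^ ((L + (c + 3)) ^ (c + 3)) := Nat.pow_le_pow_right (by norm_num) (width_arith L c)

/-! ### The composition: K1 → K2 → K3 → crux (by name) -/

/-- **The line concludes the crux.** `stub_narrowExpansionVP → stub_homPoly_close → stub_close_orbit →
OrbitRestorationQP`: expand `f n` in the narrow span (K1), realise the span certificate as one labelled
pattern expression with `(log₂ n + c)^c + 1` labels a side (K2 + linearity of `close`), build the
length-free symmetric circuit (K3) and bound `(n+1)^(2W+2)` by `2^((log₂ n + c + 3)^(c+3))`; `n = 0` is a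
constant.  [this file] -/
theorem OrbitRestorationQP_of :
    (∀ f : (n : ℕ) → MvPolynomial (Fin n × Fin n) ℂ,
      (∀ (n : ℕ) (σ τ : Equiv.Perm (Fin n)),
        MvPolynomial.rename (fun p : Fin n × Fin n => (σ p.1, τ p.2)) (f n) = f n) →
      IsVPFamily f →
      ∃ c : ℕ, ∀ n : ℕ, f n ∈ Submodule.span ℂ
        {p : MvPolynomial (Fin n × Fin n) ℂ | ∃ (a b : ℕ) (E : Multiset (Fin a × Fin b)),
          Literature.Combinatorics.SimpleGraph.treewidth
              (SimpleGraph.fromRel fun u v : Fin a ⊕ Fin b =>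
                ∃ e ∈ E, u = Sum.inl e.1 ∧ v = Sum.inr e.2) ≤ (Nat.log 2 n + c) ^ c ∧
            p = homPoly E n ℂ}) →
    (∀ (a b w : ℕ) (E : Multiset (Fin a × Fin b)),
      Literature.Combinatorics.SimpleGraph.treewidth
          (SimpleGraph.fromRel fun u v : Fin a ⊕ Fin b =>
            ∃ e ∈ E, u = Sum.inl e.1 ∧ v = Sum.inr e.2) ≤ w →
      ∀ n : ℕ, 1 ≤ n → ∀ k l : ℕ, w + 1 ≤ k → w + 1 ≤ l →
        ∃ e : PatternExpr ℂ k l, e.close n = homPoly E n ℂ) →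
    (∀ (n k l : ℕ) (e : PatternExpr ℂ k l),
      ∃ (G : Type) (_ : Fintype G) (C : LabelledArithCircuit ℂ (Fin n × Fin n) Unit G),
        C.IsSymmetric (Equiv.Perm (Fin n)) ∧ C.eval (C.output ()) = e.close n ∧
          C.orbitSize (Equiv.Perm (Fin n)) ≤ (n + 1) ^ (k + l + 2)) →
    Summit.ValiantsHypothesis.ValiantsHypothesis.Theses.MonotoneRestoration.OrbitRestorationQP := by
  intro h₁ h₂ h₃ f hsym hVP
  obtain ⟨c, hc⟩ := h₁ f hsym hVP
  refine ⟨c + 3, fun n => ?_⟩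
  rcases Nat.eq_zero_or_pos n with rfl | hn
  · -- `n = 0`: no variables, `f 0` is the constant `coeff 0 (f 0)`
    obtain ⟨G, inst, C, hC, hev, horb⟩ :=
      h₃ 0 0 0 (PatternExpr.const (MvPolynomial.coeff 0 (f 0)))
    refine ⟨G, inst, C, hC, ?_, horb.trans (le_trans (by norm_num) Nat.one_le_two_pow)⟩
    rw [hev, close_const_noLabels]
    exact (MvPolynomial.eq_C_of_isEmpty (f 0)).symm
  · -- `n ≥ 1`: span certificate → one expression with `W = (log₂ n + c)^c + 1` labels a side → circuit
    obtain ⟨e, he⟩ := exists_expr_of_mem_span h₂ n ((Nat.log 2 n + c) ^ c) hn (f n) (hc n)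
    obtain ⟨G, inst, C, hC, hev, horb⟩ :=
      h₃ n ((Nat.log 2 n + c) ^ c + 1) ((Nat.log 2 n + c) ^ c + 1) e
    exact ⟨G, inst, C, hC, by rw [hev, he], horb.trans (orbit_bound n c)⟩

/-- **The crux from the three registered stubs, discharged BY NAME** (same composition; the
sorries live only inside `stub_*`). [folklore] -/
theorem orbitRestorationQP_of_stubs :
    Summit.ValiantsHypothesis.ValiantsHypothesis.Theses.MonotoneRestoration.OrbitRestorationQP :=
  OrbitRestorationQP_of stub_narrowExpansionVP stub_homPoly_close stub_close_orbit

end Summit.ValiantsHypothesis.ValiantsHypothesis.Cruxes.OrbitRestorationQP.NarrowExpansion
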